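import Summits.QuantumFields.YangMills.Theorems.BalabanUVNodesN15CovariantLandauLetterFromFlatLeibniz
import Summits.QuantumFields.YangMills.Theorems.BalabanUVNodesN15CovariantLandauLipschitzLetter
import HarnessLib

/-!
# Route «BalabanUVNodes», node N15 = NE2, road (c) — PROGRAMME (P-S), XXIII: THE GLOBAL ROW OF THE LANDAU PERTURBATION LETTER FOR THE KNIT's TRANSPORTERS `T = coordMat e Ad_{e^{A/n}}` FROM
# THE FOUR FLAT ROWS ONLY — `A` skew, `‖A‖ ≤ r`, lattice-Lipschitz `‖A_μ(z) − A_μ(z − e_μ)‖ ≤ ℓ` with `nℓ ≤ r` ((3.35)'s first two members): n15-c∕218 with its covariant row DISCHARGED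
# (all transporter letters `ρ, λ, σ` derived: 218, 226) (dag-n15-c g23, n15-c∕232)

Cell `pub-ymgap`, seat `pub-ymgap-dag-n15-c` (generation g23; R134 (a), s1; HUMAN RULING D-0062; chair R424 venue).  `bears_on: R4∕N15 · K3⁸ SpineGivenEndpointR13SepCoPHV
(stmt-QuantumFields-27366)`; filed `--supports stmt-QuantumFields-27366 --as helper` — COUNT-NEUTRAL.  One bookkeeping `def` (`landauExpThreshold2`) + theorems; 0 `sorry`.  Imports BY NAME
n15-c∕231 (`hasMaj_landauCov_sub_of_flat''`, `cXL`, `cYL`, `cPL`), 226 (`tLetter_lip_entry∕rows`), 218 (`tLetter_rows∕nrho∕sigma`), 210 (`isUnit_cvT₀`), 182a.  Nothing in the tree is modified.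

WHY.  n15-c∕231 needs, besides the four flat rows, only the letters `ρ` (size of `T − 1`), `λ` (Lipschitz letter of `T`), `σ` (staircases) with `nρ ≤ C_ρr`, `n·(nλ) ≤ C_λr`, `σ ≤ C_σr`.
For `T = coordMat e Ad_{e^{A/n}}`: `C_ρ = 2|ι|κm` (218), `C_σ = 2(d+1)C_ρ` (218), and — NEW — `C_λ = e·|ι|κm` from n15-c∕226 (`λ ≤ |ι|κm·e^{r/n}·ℓ/n`, `nℓ ≤ r`, `e^{r/n} ≤ e`).  Hence the global
row of `N_V^R` for the knit's transporters rests on the FOUR FLAT ROWS ALONE (theorems on the cover's tori by 220∕222b), below the threshold `landauExpThreshold2`.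
* `landauExpThreshold2`; `tLetter_lip_cols`; ★★★ **`hasMaj_landauCov_sub_exp_of_flat''`** (mass window `a_w·n^{d+1}`, `0 < a_w ≤ 1`).

HONEST FRAMING ∕ LIMITS.  Bookkeeping + real arithmetic; the four flat rows are HYPOTHESES here; MODEL transporters (site data, Ad of `e^{A/n}`); NOT [Balaban1985BackgroundPropagators]
(3.49) ∕ Thms 3.1–3.4 as printed; NE2⁺ NOT PRINTED; N15 of record untouched (DISCHARGED AS CONSUMED, p687738); counts UNMOVED (typed 28∕28 · discharged 8∕27); one finite 𝕋⁴ at fixed ε per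
index — NOT infinite volume ∕ OS ∕ mass gap ∕ Clay.  Restate-immune (no Theses import).
-/

noncomputable section

open scoped BigOperators Matrix

namespace Summit.QuantumFields.YangMills.BalabanUVNodes.N15.Gluing

open Literature.MathematicalPhysics.QuantumFieldTheory.Balaban1983to89
open Literature.MathematicalPhysics.QuantumFieldTheory.Balaban1983to89.B5Prop11Plancherel (Tor fine unitVec)
open Literature.MathematicalPhysics.QuantumFieldTheory.Balaban1983to89.B11SectG (BlockNorm HasMaj)
open Literature.MathematicalPhysics.QuantumFieldTheory.Balaban1983to89.B6UnitTorusCarrier (unitTorusGeo unitTorusGeo_dist_nonneg)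
open Literature.MathematicalPhysics.QuantumFieldTheory.King1986.Torus (blockOf tdistT)
open Summit.QuantumFields.YangMills.BalabanUVNodes.N15.MatrixSpecies (liftBlk basisConst basisConst_nonneg)
open Summit.QuantumFields.YangMills.BalabanUVNodes.N15.CovAvg (cvaStair cvaStair_one rows_cvaStair_sub_one_le cols_cvaStair_sub_one_le)
open Summit.QuantumFields.YangMills.BalabanUVNodes.N15.CovLandau (cgrad csavg cGreen cSop landauCov landauSmallConst landauRowConst cXL cYL cAL cPL hasMaj_landauCov_sub_of_flat'')
open Summit.QuantumFields.YangMills.BalabanUVNodes.N15.CurvedSpecies (exp_smul_unitary_of_conjTranspose)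

variable {d : ℕ}

section Exp

open scoped Matrix.Norms.L2Operator

variable (M : Fin (d + 1) → ℕ) [∀ μ, NeZero (M μ)] (n : ℕ) [NeZero n] {ι : Type} [Fintype ι] [DecidableEq ι] (L k : ℕ)
  {mm : Type} [Fintype mm] [DecidableEq mm] (e : Matrix mm mm ℂ ≃L[ℝ] (ι → ℝ))

/-- THE THRESHOLD of this file (`κm = κ_e·2√m·√m`, `C_ρ = 2Iκm`, `C_λ = e·Iκm`, `C_σ = 2D·C_ρ`, `c₈ = c(δ/8)`, `c₃₂ = c(δ/32)`). [folklore] -/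
def landauExpThreshold2 (D I κm cG cA cD cS c8 c32 δ : ℝ) : ℝ :=
  1 / (2 + D * (2 * I * κm)
    + (2 * cXL D cG cA (2 * I * κm) (Real.exp 1 * I * κm) (2 * D * (2 * I * κm)) 1 c8 δ (δ / 8) * c8 + 2 * cYL D cD (2 * I * κm) c8 δ * c8 + 2 * D * (2 * I * κm))
    + landauSmallConst D I cG cA cD cS (cPL D cG cD (2 * I * κm) (Real.exp 1 * I * κm) (2 * D * (2 * I * κm)) 1 c8 δ (δ / 8)) (2 * I * κm) (2 * D * (2 * I * κm)) 1 c32 (δ / 2) + 1)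

/-- the COLUMN Lipschitz letter (same bound as the row letter of n15-c∕226). [cite: Balaban1985BackgroundPropagators, (3.35) p.396 (shape)] -/
theorem tLetter_lip_cols {A : Fin (d + 1) → Tor (fine n M) × Fin (d + 1) → Matrix mm mm ℂ} (hAs : ∀ μ p, (A μ p)ᴴ = -A μ p) {r ℓ : ℝ} (hA : ∀ μ p, ‖A μ p‖ ≤ r)
    (hℓ : ∀ μ (z : Tor (fine n M)), ‖A μ (z, μ) - A μ (z - unitVec (fine n M) μ, μ)‖ ≤ ℓ) (μ : Fin (d + 1)) (z : Tor (fine n M)) (i : ι) :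
    ∑ j, |((cvT₀ e (fun μ p => NormedSpace.exp ((((n : ℕ) : ℝ))⁻¹ • A μ p))) μ z - (cvT₀ e (fun μ p => NormedSpace.exp ((((n : ℕ) : ℝ))⁻¹ • A μ p))) μ (z - unitVec (fine n M) μ)) j i| ≤ Fintype.card ι * (@basisConst ι _ (Matrix mm mm ℂ) Matrix.frobeniusNormedAddCommGroup Matrix.frobeniusNormedSpace e * (2 * Real.sqrt (Fintype.card mm)) * (Real.sqrt (Fintype.card mm) * (Real.exp ((((n : ℕ) : ℝ))⁻¹ * r) * ((((n : ℕ) : ℝ))⁻¹ * ℓ)))) := by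
  calc _ ≤ ∑ _j : ι, @basisConst ι _ (Matrix mm mm ℂ) Matrix.frobeniusNormedAddCommGroup Matrix.frobeniusNormedSpace e * (2 * Real.sqrt (Fintype.card mm)) * (Real.sqrt (Fintype.card mm) * (Real.exp ((((n : ℕ) : ℝ))⁻¹ * r) * ((((n : ℕ) : ℝ))⁻¹ * ℓ))) :=
        Finset.sum_le_sum fun j _ => tLetter_lip_entry M n e hAs hA hℓ μ z j i
    _ = _ := by rw [Finset.sum_const, Finset.card_univ, nsmul_eq_mul]

set_option maxHeartbeats 1000000 in
/-- ★★★ **THE GLOBAL ROW OF THE LANDAU PERTURBATION LETTER FOR `T = coordMat e Ad_{e^{A/n}}` FROM THE FOUR FLAT ROWS ONLY** (`A` skew, `‖A‖ ≤ r`, `‖A_μ(z) − A_μ(z − e_μ)‖ ≤ ℓ`, `nℓ ≤ r`,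
`r ≤ landauExpThreshold2`; mass `a_w·n^{d+1}`, `0 < a_w ≤ 1`).
[cite: Balaban1985BackgroundPropagators, (3.49) p.399, Thm 3.1 (3.42) p.397, Thm 3.2 (3.48) p.398, Thm 3.4 p.400, (3.35)–(3.37) p.396; Balaban1984PropagatorsII, Props. 2.2–2.3 pp.228–231] -/
theorem hasMaj_landauCov_sub_exp_of_flat'' {aw : ℝ} (haw0 : 0 < aw) (haw1 : aw ≤ 1) {A : Fin (d + 1) → Tor (fine n M) × Fin (d + 1) → Matrix mm mm ℂ} (hAs : ∀ μ p, (A μ p)ᴴ = -A μ p)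
    {r ℓ : ℝ} (hr0 : 0 ≤ r) (hℓ0 : 0 ≤ ℓ) (hA : ∀ μ p, ‖A μ p‖ ≤ r) (hℓ : ∀ μ (z : Tor (fine n M)), ‖A μ (z, μ) - A μ (z - unitVec (fine n M) μ, μ)‖ ≤ ℓ) (hnℓ : (n : ℝ) * ℓ ≤ r)
    {δ CG CA CD CS : ℝ} (hδ : 0 < δ) (hCG : 0 ≤ CG) (hCA : 0 ≤ CA) (hCD : 0 ≤ CD) (hCS : 0 ≤ CS)
    (hG1 : HasMaj (BlockNorm.ofBlocks (unitTorusGeo L k M) (liftBlk (blockOf n M) ι)) (BlockNorm.ofBlocks (unitTorusGeo L k M) (liftBlk (blockOf n M) ι)) (Matrix.mulVecLin (cGreen M n (fun (_ : Fin (d + 1)) (_ : Tor (fine n M)) => (1 : Matrix ι ι ℝ)) (aw * (n : ℝ) ^ (d + 1)))) (fun y y' => CG * Real.exp (-(δ * tdistT M y y'))))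
    (hA1 : HasMaj (BlockNorm.ofBlocks (unitTorusGeo L k M) (liftBlk (fun b : Tor (fine n M) × Fin (d + 1) => blockOf n M b.1) ι)) (BlockNorm.ofBlocks (unitTorusGeo L k M) (liftBlk (blockOf n M) ι)) (Matrix.mulVecLin (cGreen M n (fun (_ : Fin (d + 1)) (_ : Tor (fine n M)) => (1 : Matrix ι ι ℝ)) (aw * (n : ℝ) ^ (d + 1)) * (cgrad M n (fun (_ : Fin (d + 1)) (_ : Tor (fine n M)) => (1 : Matrix ι ι ℝ)))ᵀ)) (fun y y' => CA * Real.exp (-(δ * tdistT M y y'))))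
    (hD1 : HasMaj (BlockNorm.ofBlocks (unitTorusGeo L k M) (liftBlk (blockOf n M) ι)) (BlockNorm.ofBlocks (unitTorusGeo L k M) (liftBlk (fun b : Tor (fine n M) × Fin (d + 1) => blockOf n M b.1) ι)) (Matrix.mulVecLin (cgrad M n (fun (_ : Fin (d + 1)) (_ : Tor (fine n M)) => (1 : Matrix ι ι ℝ)) * cGreen M n (fun (_ : Fin (d + 1)) (_ : Tor (fine n M)) => (1 : Matrix ι ι ℝ)) (aw * (n : ℝ) ^ (d + 1)))) (fun y y' => CD * Real.exp (-(δ * tdistT M y y'))))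
    (hS1 : HasMaj (BlockNorm.ofBlocks (unitTorusGeo L k M) (liftBlk (fun y : Tor M => y) ι)) (BlockNorm.ofBlocks (unitTorusGeo L k M) (liftBlk (fun y : Tor M => y) ι)) (Matrix.mulVecLin (cSop M n (fun (_ : Fin (d + 1)) (_ : Tor (fine n M)) => (1 : Matrix ι ι ℝ)) (aw * (n : ℝ) ^ (d + 1)))⁻¹) (fun y y' => CS * (n : ℝ) ^ (d + 1) * Real.exp (-(δ * tdistT M y y'))))
    (hsmall : r ≤ landauExpThreshold2 ((d : ℝ) + 1) (Fintype.card ι) (@basisConst ι _ (Matrix mm mm ℂ) Matrix.frobeniusNormedAddCommGroup Matrix.frobeniusNormedSpace e * (2 * Real.sqrt (Fintype.card mm)) * Real.sqrt (Fintype.card mm)) CG CA CD CS (B4Sect5Proof.latticeConst (d + 1) (δ / 8)) (B4Sect5Proof.latticeConst (d + 1) (δ / 2 / 16)) δ) :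
    HasMaj (BlockNorm.ofBlocks (unitTorusGeo L k M) (liftBlk (fun b : Tor (fine n M) × Fin (d + 1) => blockOf n M b.1) ι)) (BlockNorm.ofBlocks (unitTorusGeo L k M) (liftBlk (fun b : Tor (fine n M) × Fin (d + 1) => blockOf n M b.1) ι)) (Matrix.mulVecLin (landauCov M n (cvT₀ e (fun μ p => NormedSpace.exp ((((n : ℕ) : ℝ))⁻¹ • A μ p))) (aw * (n : ℝ) ^ (d + 1)) - landauCov M n (fun (_ : Fin (d + 1)) (_ : Tor (fine n M)) => (1 : Matrix ι ι ℝ)) (aw * (n : ℝ) ^ (d + 1))))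
      (fun y y' => landauRowConst ((d : ℝ) + 1) (Fintype.card ι) CG CA CD CS
          (cPL ((d : ℝ) + 1) CG CD (2 * Fintype.card ι * (@basisConst ι _ (Matrix mm mm ℂ) Matrix.frobeniusNormedAddCommGroup Matrix.frobeniusNormedSpace e * (2 * Real.sqrt (Fintype.card mm)) * Real.sqrt (Fintype.card mm))) (Real.exp 1 * Fintype.card ι * (@basisConst ι _ (Matrix mm mm ℂ) Matrix.frobeniusNormedAddCommGroup Matrix.frobeniusNormedSpace e * (2 * Real.sqrt (Fintype.card mm)) * Real.sqrt (Fintype.card mm))) (2 * ((d : ℝ) + 1) * (2 * Fintype.card ι * (@basisConst ι _ (Matrix mm mm ℂ) Matrix.frobeniusNormedAddCommGroup Matrix.frobeniusNormedSpace e * (2 * Real.sqrt (Fintype.card mm)) * Real.sqrt (Fintype.card mm)))) 1 (B4Sect5Proof.latticeConst (d + 1) (δ / 8)) δ (δ / 8))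
          (2 * Fintype.card ι * (@basisConst ι _ (Matrix mm mm ℂ) Matrix.frobeniusNormedAddCommGroup Matrix.frobeniusNormedSpace e * (2 * Real.sqrt (Fintype.card mm)) * Real.sqrt (Fintype.card mm))) (2 * ((d : ℝ) + 1) * (2 * Fintype.card ι * (@basisConst ι _ (Matrix mm mm ℂ) Matrix.frobeniusNormedAddCommGroup Matrix.frobeniusNormedSpace e * (2 * Real.sqrt (Fintype.card mm)) * Real.sqrt (Fintype.card mm)))) 1
          (B4Sect5Proof.latticeConst (d + 1) (δ / 2 / 16)) (B4Sect5Proof.latticeConst (d + 1) (3 * (δ / 2) / 4 / 8)) (δ / 2) * r * Real.exp (-((3 * (δ / 2) / 8) * tdistT M y y'))) := by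
  -- abbreviations (opaque)
  obtain ⟨κm, hκmdef⟩ : ∃ x : ℝ, x = (@basisConst ι _ (Matrix mm mm ℂ) Matrix.frobeniusNormedAddCommGroup Matrix.frobeniusNormedSpace e * (2 * Real.sqrt (Fintype.card mm)) * Real.sqrt (Fintype.card mm)) := ⟨_, rfl⟩
  have hκm : 0 ≤ κm := by rw [hκmdef]; have := @basisConst_nonneg ι _ (Matrix mm mm ℂ) Matrix.frobeniusNormedAddCommGroup Matrix.frobeniusNormedSpace e; positivity
  obtain ⟨Cρ, hCρdef⟩ : ∃ x : ℝ, x = 2 * Fintype.card ι * κm := ⟨_, rfl⟩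
  have hCρ : 0 ≤ Cρ := by rw [hCρdef]; positivity
  obtain ⟨Cl, hCldef⟩ : ∃ x : ℝ, x = Real.exp 1 * Fintype.card ι * κm := ⟨_, rfl⟩
  have hCl : 0 ≤ Cl := by rw [hCldef]; positivity
  obtain ⟨c8, hc8def⟩ : ∃ x : ℝ, x = B4Sect5Proof.latticeConst (d + 1) (δ / 8) := ⟨_, rfl⟩
  have hc8 : 0 ≤ c8 := by rw [hc8def]; exact B4Sect5Proof.latticeConst_nonneg (d + 1) (by positivity)
  obtain ⟨c32, hc32def⟩ : ∃ x : ℝ, x = B4Sect5Proof.latticeConst (d + 1) (δ / 2 / 16) := ⟨_, rfl⟩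
  have hc32 : 0 ≤ c32 := by rw [hc32def]; exact B4Sect5Proof.latticeConst_nonneg (d + 1) (by positivity)
  obtain ⟨SL, hSLdef⟩ : ∃ x : ℝ, x = 2 * cXL ((d : ℝ) + 1) CG CA Cρ Cl (2 * ((d : ℝ) + 1) * Cρ) 1 c8 δ (δ / 8) * c8 + 2 * cYL ((d : ℝ) + 1) CD Cρ c8 δ * c8 + 2 * ((d : ℝ) + 1) * Cρ := ⟨_, rfl⟩
  have hSL : 0 ≤ SL := by rw [hSLdef]; unfold cXL cYL; positivity
  obtain ⟨S2, hS2def⟩ : ∃ x : ℝ, x = landauSmallConst ((d : ℝ) + 1) (Fintype.card ι) CG CA CD CS (cPL ((d : ℝ) + 1) CG CD Cρ Cl (2 * ((d : ℝ) + 1) * Cρ) 1 c8 δ (δ / 8)) Cρ (2 * ((d : ℝ) + 1) * Cρ) 1 c32 (δ / 2) := ⟨_, rfl⟩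
  have hS2 : 0 ≤ S2 := by
    rw [hS2def]; unfold landauSmallConst CovLandau.cK1 CovLandau.cB0 CovLandau.cM2 CovLandau.cPG0 CovLandau.cA0 cPL cAL cYL; positivity
  have hthr : landauExpThreshold2 ((d : ℝ) + 1) (Fintype.card ι) κm CG CA CD CS c8 c32 δ = 1 / (2 + ((d : ℝ) + 1) * Cρ + SL + S2 + 1) := by
    rw [hSLdef, hS2def, hCρdef, hCldef]; rfl
  have hsmall' : r ≤ 1 / (2 + ((d : ℝ) + 1) * Cρ + SL + S2 + 1) := by rw [← hthr, hκmdef, hc8def, hc32def]; exact hsmall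
  have hden : 0 < 2 + ((d : ℝ) + 1) * Cρ + SL + S2 + 1 := by positivity
  have hrd : r * (2 + ((d : ℝ) + 1) * Cρ + SL + S2 + 1) ≤ 1 := by
    have := mul_le_mul_of_nonneg_right hsmall' hden.le
    rwa [one_div, inv_mul_cancel₀ hden.ne'] at this
  have hDC0 : 0 ≤ ((d : ℝ) + 1) * Cρ := by positivity
  have hr1 : r ≤ 1 := by nlinarith only [hrd, hDC0, hSL, hS2, hr0]
  have hsm1 : ((d : ℝ) + 1) * Cρ * r ≤ 1 := by nlinarith only [hrd, hDC0, hSL, hS2, hr0]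
  have hsmL : SL * r ≤ 1 := by nlinarith only [hrd, hDC0, hSL, hS2, hr0]
  have hsm2 : S2 * r ≤ 1 := by nlinarith only [hrd, hDC0, hSL, hS2, hr0]
  -- the datum and its letters
  have hη : (0 : ℝ) ≤ (((n : ℕ) : ℝ))⁻¹ := by positivity
  have hn1 : (1 : ℝ) ≤ (n : ℝ) := by exact_mod_cast Nat.one_le_iff_ne_zero.mpr (NeZero.ne n)
  have hnpos : (0 : ℝ) < (n : ℝ) := by linarith
  have hU : ∀ ν (p : Tor (fine n M) × Fin (d + 1)), (NormedSpace.exp ((((n : ℕ) : ℝ))⁻¹ • A ν p))ᴴ * NormedSpace.exp ((((n : ℕ) : ℝ))⁻¹ • A ν p) = 1 :=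
    fun ν p => exp_smul_unitary_of_conjTranspose (hAs ν p) _
  have hT : ∀ ν x, IsUnit ((cvT₀ e (fun μ p => NormedSpace.exp ((((n : ℕ) : ℝ))⁻¹ • A μ p))) ν x) := fun ν x => isUnit_cvT₀ e hU ν x
  obtain ⟨hρr, hρc⟩ := tLetter_rows M n e hAs hA
  have hρ0 : 0 ≤ Fintype.card ι * (@basisConst ι _ (Matrix mm mm ℂ) Matrix.frobeniusNormedAddCommGroup Matrix.frobeniusNormedSpace e * (2 * Real.sqrt (Fintype.card mm)) * (Real.sqrt (Fintype.card mm) * (Real.exp ((((n : ℕ) : ℝ))⁻¹ * r) - 1))) := by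
    have hκ := @basisConst_nonneg ι _ (Matrix mm mm ℂ) Matrix.frobeniusNormedAddCommGroup Matrix.frobeniusNormedSpace e
    have : 0 ≤ Real.exp ((((n : ℕ) : ℝ))⁻¹ * r) - 1 := by have := Real.add_one_le_exp ((((n : ℕ) : ℝ))⁻¹ * r); nlinarith only [this, show 0 ≤ (((n : ℕ) : ℝ))⁻¹ * r by positivity]
    positivity
  have hnρ : (n : ℝ) * (Fintype.card ι * (@basisConst ι _ (Matrix mm mm ℂ) Matrix.frobeniusNormedAddCommGroup Matrix.frobeniusNormedSpace e * (2 * Real.sqrt (Fintype.card mm)) * (Real.sqrt (Fintype.card mm) * (Real.exp ((((n : ℕ) : ℝ))⁻¹ * r) - 1)))) ≤ Cρ * r := by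
    have h := tLetter_nrho (ι := ι) n hκm hr0 hr1
    rw [← hCρdef, hκmdef] at h
    refine le_trans (le_of_eq ?_) h
    ring
  -- the Lipschitz letters
  have hlamr := tLetter_lip_rows M n e hAs hA hℓ
  have hlamc := tLetter_lip_cols M n e hAs hA hℓ
  have hlam0 : 0 ≤ Fintype.card ι * (@basisConst ι _ (Matrix mm mm ℂ) Matrix.frobeniusNormedAddCommGroup Matrix.frobeniusNormedSpace e * (2 * Real.sqrt (Fintype.card mm)) * (Real.sqrt (Fintype.card mm) * (Real.exp ((((n : ℕ) : ℝ))⁻¹ * r) * ((((n : ℕ) : ℝ))⁻¹ * ℓ)))) := by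
    have hκ := @basisConst_nonneg ι _ (Matrix mm mm ℂ) Matrix.frobeniusNormedAddCommGroup Matrix.frobeniusNormedSpace e
    positivity
  have hnlam : (n : ℝ) * ((n : ℝ) * (Fintype.card ι * (@basisConst ι _ (Matrix mm mm ℂ) Matrix.frobeniusNormedAddCommGroup Matrix.frobeniusNormedSpace e * (2 * Real.sqrt (Fintype.card mm)) * (Real.sqrt (Fintype.card mm) * (Real.exp ((((n : ℕ) : ℝ))⁻¹ * r) * ((((n : ℕ) : ℝ))⁻¹ * ℓ)))))) ≤ Cl * r := by
    have hx1 : (((n : ℕ) : ℝ))⁻¹ * r ≤ 1 := by rw [inv_mul_le_iff₀ hnpos]; linarith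
    have hex : Real.exp ((((n : ℕ) : ℝ))⁻¹ * r) ≤ Real.exp 1 := Real.exp_le_exp.mpr hx1
    have hκ := @basisConst_nonneg ι _ (Matrix mm mm ℂ) Matrix.frobeniusNormedAddCommGroup Matrix.frobeniusNormedSpace e
    have e1 : (n : ℝ) * ((n : ℝ) * (Fintype.card ι * (@basisConst ι _ (Matrix mm mm ℂ) Matrix.frobeniusNormedAddCommGroup Matrix.frobeniusNormedSpace e * (2 * Real.sqrt (Fintype.card mm)) * (Real.sqrt (Fintype.card mm) * (Real.exp ((((n : ℕ) : ℝ))⁻¹ * r) * ((((n : ℕ) : ℝ))⁻¹ * ℓ)))))) = Fintype.card ι * κm * (Real.exp ((((n : ℕ) : ℝ))⁻¹ * r) * ((n : ℝ) * ℓ)) := by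
      rw [hκmdef]; field_simp
    rw [e1, hCldef]
    calc Fintype.card ι * κm * (Real.exp ((((n : ℕ) : ℝ))⁻¹ * r) * ((n : ℝ) * ℓ)) ≤ Fintype.card ι * κm * (Real.exp 1 * r) := by gcongr
      _ = Real.exp 1 * Fintype.card ι * κm * r := by ring
  -- the staircase differences
  have e1 : ∀ (y : Tor M) (a' : Fin (d + 1) → Fin n), cvaStair M n (fun μ (b : Tor (fine n M) × Fin (d + 1)) => (fun (_ : Fin (d + 1)) (_ : Tor (fine n M)) => (1 : Matrix ι ι ℝ)) μ b.1) y a' 0 = 1 := fun y a' => cvaStair_one M n y a' 0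
  have hσr : ∀ y a' i, ∑ j, |(cvaStair M n (fun μ b => (cvT₀ e (fun μ p => NormedSpace.exp ((((n : ℕ) : ℝ))⁻¹ • A μ p))) μ b.1) y a' 0 - cvaStair M n (fun μ b => (fun (_ : Fin (d + 1)) (_ : Tor (fine n M)) => (1 : Matrix ι ι ℝ)) μ b.1) y a' 0) i j| ≤ (1 + Fintype.card ι * (@basisConst ι _ (Matrix mm mm ℂ) Matrix.frobeniusNormedAddCommGroup Matrix.frobeniusNormedSpace e * (2 * Real.sqrt (Fintype.card mm)) * (Real.sqrt (Fintype.card mm) * (Real.exp ((((n : ℕ) : ℝ))⁻¹ * r) - 1)))) ^ ((d + 1) * n) - 1 := by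
    intro y a' i
    rw [e1]
    exact rows_cvaStair_sub_one_le M n hρ0 (T := fun μ b => (cvT₀ e (fun μ p => NormedSpace.exp ((((n : ℕ) : ℝ))⁻¹ • A μ p))) μ b.1) (fun μ p i' => hρr μ p.1 i') y a' 0 i
  have hσc : ∀ y a' j, ∑ i, |(cvaStair M n (fun μ b => (cvT₀ e (fun μ p => NormedSpace.exp ((((n : ℕ) : ℝ))⁻¹ • A μ p))) μ b.1) y a' 0 - cvaStair M n (fun μ b => (fun (_ : Fin (d + 1)) (_ : Tor (fine n M)) => (1 : Matrix ι ι ℝ)) μ b.1) y a' 0) i j| ≤ (1 + Fintype.card ι * (@basisConst ι _ (Matrix mm mm ℂ) Matrix.frobeniusNormedAddCommGroup Matrix.frobeniusNormedSpace e * (2 * Real.sqrt (Fintype.card mm)) * (Real.sqrt (Fintype.card mm) * (Real.exp ((((n : ℕ) : ℝ))⁻¹ * r) - 1)))) ^ ((d + 1) * n) - 1 := by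
    intro y a' j
    rw [e1]
    exact cols_cvaStair_sub_one_le M n hρ0 (T := fun μ b => (cvT₀ e (fun μ p => NormedSpace.exp ((((n : ℕ) : ℝ))⁻¹ • A μ p))) μ b.1) (fun μ p j' => hρc μ p.1 j') y a' 0 j
  have hσ0 : 0 ≤ (1 + Fintype.card ι * (@basisConst ι _ (Matrix mm mm ℂ) Matrix.frobeniusNormedAddCommGroup Matrix.frobeniusNormedSpace e * (2 * Real.sqrt (Fintype.card mm)) * (Real.sqrt (Fintype.card mm) * (Real.exp ((((n : ℕ) : ℝ))⁻¹ * r) - 1)))) ^ ((d + 1) * n) - 1 := by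
    have := one_le_pow₀ (M₀ := ℝ) (a := 1 + Fintype.card ι * (@basisConst ι _ (Matrix mm mm ℂ) Matrix.frobeniusNormedAddCommGroup Matrix.frobeniusNormedSpace e * (2 * Real.sqrt (Fintype.card mm)) * (Real.sqrt (Fintype.card mm) * (Real.exp ((((n : ℕ) : ℝ))⁻¹ * r) - 1)))) (by linarith only [hρ0]) (n := (d + 1) * n)
    linarith only [this]
  have hσle := tLetter_sigma (d := d) n hρ0 hnρ hsm1
  -- n15-c∕231
  have hn : (0 : ℝ) < (n : ℝ) ^ (d + 1) := pow_pos hnpos _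
  have hna : (0 : ℝ) < aw * (n : ℝ) ^ (d + 1) := mul_pos haw0 hn
  have haα : |(aw * (n : ℝ) ^ (d + 1))| * ((n : ℝ) ^ (d + 1))⁻¹ ≤ 1 := by
    rw [abs_of_pos hna, mul_assoc, mul_inv_cancel₀ hn.ne', mul_one]; exact haw1
  have hsmL' : (2 * cXL ((d : ℝ) + 1) CG CA Cρ Cl (2 * ((d : ℝ) + 1) * Cρ) 1 (B4Sect5Proof.latticeConst (d + 1) (δ / 8)) δ (δ / 8) * B4Sect5Proof.latticeConst (d + 1) (δ / 8)
      + 2 * cYL ((d : ℝ) + 1) CD Cρ (B4Sect5Proof.latticeConst (d + 1) (δ / 8)) δ * B4Sect5Proof.latticeConst (d + 1) (δ / 8) + 2 * ((d : ℝ) + 1) * Cρ) * r ≤ 1 := by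
    rw [← hc8def, ← hSLdef]; exact hsmL
  have hsm2' : landauSmallConst ((d : ℝ) + 1) (Fintype.card ι) CG CA CD CS (cPL ((d : ℝ) + 1) CG CD Cρ Cl (2 * ((d : ℝ) + 1) * Cρ) 1 (B4Sect5Proof.latticeConst (d + 1) (δ / 8)) δ (δ / 8)) Cρ (2 * ((d : ℝ) + 1) * Cρ) 1
      (B4Sect5Proof.latticeConst (d + 1) (δ / 2 / 16)) (δ / 2) * r ≤ 1 := by
    rw [← hc8def, ← hc32def, ← hS2def]; exact hsm2
  have key := hasMaj_landauCov_sub_of_flat'' M n L k hT hna hδ hCG hCA hCD hCS hCρ hCl (by positivity : 0 ≤ 2 * ((d : ℝ) + 1) * Cρ) zero_le_one hr0 hr1 hρ0 hlam0 hσ0 haα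
    hρr hρc hlamr hlamc hσr hσc hnρ hnlam hσle hG1 hA1 hD1 hS1 hsmL' hsm2'
  rw [hCρdef, hCldef, hκmdef] at key
  exact key

end Exp

end Summit.QuantumFields.YangMills.BalabanUVNodes.N15.Gluing

end
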